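import Summits.HodgeConjecture.HodgeConjecture.Theorems.R90S4TwistedTransferDefs      -- ★ C-TT: `IsEpsRegularAt`, (via ★ `R90S4TwistedNormMapLocal`) `IsEpsNormPair`, `epsLoc_apply_coe`, `epsLoc_eq_self_iff_mem_local`; ★ `R90S4TwistedNormMap` §1–§2 (`apply_epsNorm`, `epsCentralizer_le_centralizer_epsNorm`); ★ `Ch4Sec10` (`epsCentralizer`, `epsNorm`), ★ `Ch4Sec10Bridge.mem_epsCentralizer_iff`
import Literature.LinearAlgebra.Matrix.CentraliserOfSeparableCharpoly                   -- ★ `Matrix.GeneralLinearGroup.commute_of_commute_of_charpoly_separable` (regular ⇒ centraliser abelian)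
import HarnessLib

/-!
# R90-TF · S4 «Ch. 13.1–2», brick (W5-B3) NORM-TORI, first file — THE ε-CENTRALISER OF AN ε-REGULAR `δ` IS THE CENTRALISER OF ITS NORM IN `G_v`:
# `G̃_{δε} ≅ G_γ` for `γ ∈ 𝒩(δ)` (Rogawski 1990, §3.10 (3.10.1), §3.11 Prop. 3.11.2; the torus of the twisted Weyl integration formula, §12.5 p. 186)

Cell `hodgecm-mathlib`, crux H413 (`stmt-HodgeConjecture-24833`, lane `--supports … --as helper`), route of record `HCCMUnconditional` (no route verbs;
count-neutral).  Programme R90-TF, section S4 = [Rogawski1990] Ch. 13.1–13.2 (dealer K2E2-plan (g6)); seat K2E3-p36 (g2), dealt BY NAME «(W5-B3) NORM-TORI first file»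
(RULING S4-R11 (c), `R90/STATUS.md` 2026-09-04T22:36:15Z) after the census `R90/S4/CENSUS-1DCT.K2E3-p36.md` (brick B3 of the road to the named input (1D-CT)
`stub_R90_S4_oneDimCharTransfer` ∕ the twisted Weyl integration formula T-WIF).  THEOREMS ONLY — no `def`, no instance, no notation, no `sorry`; ★-only imports.

HONEST LABEL: HC_CM is proved only modulo the 7 printed citations (2 remaining named inputs: hLiu418 = stmt-HodgeConjecture-24832, h413 =
stmt-HodgeConjecture-24833) until rung 0 closes.  This file is pure group algebra + topology; it discharges no socket by itself.

## The mathematics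

PRINT.  [Rogawski1990, §3.10 (3.10.1) p. 34]: `G̃_{δε} ⊂ G̃_{Nδ}`; [§3.11 Prop. 3.11.2 pp. 34–35]: for `δ` with `N(δ)` regular, the ε-centraliser `G̃_{δε}` is (the
`F`-points of) a maximal torus of `G` — precisely, if `γ ∈ 𝒩(δ)`, i.e. `γ ∈ G` is `G̃`-conjugate to `N(δ) = δ ε(δ)`, then `G̃_{δε}` and `G_γ = Cent_G(γ)` are conjugate
tori; [§12.5 p. 186]: the twisted Weyl integration formula integrates over these tori and uses `D_{G̃ε}(δ) = D_G(Nδ)`.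

HERE (§1 generic: any group `G`, any `ε : G →* G` with `ε ∘ ε = 1`; `N(δ) := δ ε(δ)` ★ `epsNorm`, `G̃_{δε} := {g : g δ ε(g)⁻¹ = δ}` ★ `epsCentralizer`).  Fix `δ x γ` with
`x N(δ) x⁻¹ = γ` and `ε γ = γ`, and suppose `Cent(N(δ))` is COMMUTATIVE (§2: automatic for ε-regular `δ`).  Put `θ := Ad(δ) ∘ ε` and `w := x⁻¹ ε(x) δ⁻¹`.
* `w ∈ Cent(N(δ))` (`inv_mul_apply_mul_inv_mem_centralizer_epsNorm`): `ε γ = γ` reads `ε(x) ε(Nδ) ε(x)⁻¹ = x Nδ x⁻¹` and `ε(Nδ) = δ⁻¹ Nδ δ` (★ `apply_epsNorm`).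
* `θ` preserves `Cent(N(δ))` (`conj_apply_mem_centralizer_epsNorm`), since `θ(Nδ) = Nδ`.
* INTERTWINING (`apply_conj_eq_of_mem_centralizer_epsNorm`): for `t ∈ Cent(Nδ)`, `ε(x t x⁻¹) = x θ(t) x⁻¹` — because `ε(x) = x w δ` and `w` commutes with `θ(t)`.
* Hence (`conj_mem_centralizer_iff`, `apply_conj_eq_iff_mem_epsCentralizer`, `conj_mem_centralizer_and_apply_eq_iff`): `Ad(x)` carries `G̃_{δε} = Cent(Nδ)^θ`
  bijectively onto `Cent(γ) ∩ G̃^ε = Cent_G(γ)`.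
§2 instantiates at the S4 carriers (`G̃_v = GtLoc L v`, `ε_v = epsLoc L Φ v` for hermitian `Φ`, `G_v = (cmDatum L 3 Φ).Local v = G̃_v^{ε_v}` ★ `epsLoc_eq_self_iff_mem_local`):
for ε-REGULAR `δ` (★ `IsEpsRegularAt`: `N(δ)` has separable characteristic polynomial, so `Cent_{G̃_v}(Nδ)` is commutative by ★
`Matrix.GeneralLinearGroup.commute_of_commute_of_charpoly_separable` over `L ⊗ L⁺_v = Π_{w∣v} L_w`) and `γ ∈ 𝒩(δ)` (★ `IsEpsNormPair`), there are `x` and a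
TOPOLOGICAL-GROUP ISOMORPHISM `e : G̃_{δε} ≃ₜ* G_{v,γ}` with `e(t) = x t x⁻¹` (`exists_continuousMulEquiv_epsCentralizer_centralizer`); §3 records the D-germ: `γ` and `N(δ)`
have the same characteristic polynomial (`charpoly_coe_eq_of_isEpsNormPair`), so `γ` is regular (`isRegularElt_coe_of_isEpsNormPair`) and every weight built from the
characteristic polynomial (the datum letter `D_T` of ★ F0P3c's Weyl formula) agrees at `γ` and `N(δ)` — print's `D_{G̃ε}(δ) = D_G(Nδ)`.

[cite: Rogawski1990, §3.10 (3.10.1) p. 34; §3.11 Prop. 3.11.2 pp. 34–35; §12.5 p. 186] [cite: ArthurClozelAMS120, Ch. 1 §1 Lemma 1.1]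
-/

set_option autoImplicit false
-- the mandated namespace repeats the single-problem summit's segment (`HodgeConjecture.HodgeConjecture`)
set_option linter.dupNamespace false

noncomputable section

open scoped NumberField Matrix MatrixGroups

namespace Summit.HodgeConjecture.HodgeConjecture.R90.S4

open Literature.NumberTheory.Rogawski1990 Literature.NumberTheory.Rogawski1990.Ch4Sec10
open Literature.NumberTheory.Automorphic
open IsDedekindDomain NumberField

/-! ## §1 Generic group with an involution: `Ad(x) : G̃_{δε} → Cent(γ) ∩ G̃^ε` for `γ = x N(δ) x⁻¹` ε-fixed -/

section Generic

variable {G : Type*} [Group G] (ε : G →* G)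

/-- **`w := x⁻¹ ε(x) δ⁻¹` centralises `N(δ)`** when `γ = x N(δ) x⁻¹` is `ε`-fixed: `ε(γ) = γ` reads `ε(x) ε(Nδ) ε(x)⁻¹ = x Nδ x⁻¹`, and `ε(Nδ) = δ⁻¹ Nδ δ`
(★ `apply_epsNorm`), whence `w Nδ = Nδ w`. [cite: Rogawski1990, §3.10 p. 34; §3.11 p. 35] -/
theorem inv_mul_apply_mul_inv_mem_centralizer_epsNorm (hε : ∀ g : G, ε (ε g) = g) {δ x γ : G}
    (hγ : x * epsNorm ε δ * x⁻¹ = γ) (hεγ : ε γ = γ) :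
    x⁻¹ * ε x * δ⁻¹ ∈ Subgroup.centralizer ({epsNorm ε δ} : Set G) := by
  rw [Subgroup.mem_centralizer_singleton_iff]
  have h1 : ε x * (δ⁻¹ * epsNorm ε δ * δ) * (ε x)⁻¹ = x * epsNorm ε δ * x⁻¹ := by
    rw [← apply_epsNorm ε hε δ, ← map_mul, ← map_inv, ← map_mul, hγ, hεγ]
  calc x⁻¹ * ε x * δ⁻¹ * epsNorm ε δ = x⁻¹ * (ε x * (δ⁻¹ * epsNorm ε δ * δ) * (ε x)⁻¹) * (ε x * δ⁻¹) := by group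
    _ = x⁻¹ * (x * epsNorm ε δ * x⁻¹) * (ε x * δ⁻¹) := by rw [h1]
    _ = epsNorm ε δ * (x⁻¹ * ε x * δ⁻¹) := by group

/-- **`θ := Ad(δ) ∘ ε` preserves `Cent(N(δ))`**: `θ(Nδ) = δ ε(δ ε δ) δ⁻¹ = Nδ`, so `t Nδ = Nδ t` gives `θ(t) Nδ = Nδ θ(t)`.
[cite: Rogawski1990, §3.10 p. 34] -/
theorem conj_apply_mem_centralizer_epsNorm (hε : ∀ g : G, ε (ε g) = g) (δ : G) {t : G}
    (ht : t ∈ Subgroup.centralizer ({epsNorm ε δ} : Set G)) :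
    δ * ε t * δ⁻¹ ∈ Subgroup.centralizer ({epsNorm ε δ} : Set G) := by
  rw [Subgroup.mem_centralizer_singleton_iff] at ht ⊢
  have h : ε t * (ε δ * δ) = ε δ * δ * ε t := by
    have h0 := congrArg ε ht
    simpa only [map_mul, epsNorm, hε, mul_assoc] using h0
  calc δ * ε t * δ⁻¹ * epsNorm ε δ = δ * (ε t * (ε δ * δ)) * δ⁻¹ := by simp only [epsNorm]; group
    _ = δ * (ε δ * δ * ε t) * δ⁻¹ := by rw [h]
    _ = epsNorm ε δ * (δ * ε t * δ⁻¹) := by simp only [epsNorm]; group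

/-- **INTERTWINING `ε ∘ Ad(x) = Ad(x) ∘ (Ad(δ) ∘ ε)` ON `Cent(N(δ))`**: for `γ = x N(δ) x⁻¹` `ε`-fixed, `Cent(Nδ)` commutative and `t ∈ Cent(Nδ)`,
`ε(x t x⁻¹) = x (δ ε(t) δ⁻¹) x⁻¹` — write `ε(x) = x w δ` with `w = x⁻¹ ε(x) δ⁻¹ ∈ Cent(Nδ)` and commute `w` past `δ ε(t) δ⁻¹ ∈ Cent(Nδ)`.
[cite: Rogawski1990, §3.11 Prop. 3.11.2 pp. 34–35] [cite: ArthurClozelAMS120, Ch. 1 §1 Lemma 1.1] -/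
theorem apply_conj_eq_of_mem_centralizer_epsNorm (hε : ∀ g : G, ε (ε g) = g) {δ x γ : G}
    (hγ : x * epsNorm ε δ * x⁻¹ = γ) (hεγ : ε γ = γ)
    (hcomm : ∀ a ∈ Subgroup.centralizer ({epsNorm ε δ} : Set G), ∀ b ∈ Subgroup.centralizer ({epsNorm ε δ} : Set G), a * b = b * a)
    {t : G} (ht : t ∈ Subgroup.centralizer ({epsNorm ε δ} : Set G)) :
    ε (x * t * x⁻¹) = x * (δ * ε t * δ⁻¹) * x⁻¹ := by
  have hw := inv_mul_apply_mul_inv_mem_centralizer_epsNorm ε hε hγ hεγ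
  have hθt := conj_apply_mem_centralizer_epsNorm ε hε δ ht
  calc ε (x * t * x⁻¹) = ε x * ε t * (ε x)⁻¹ := by rw [map_mul, map_mul, map_inv]
    _ = x * ((x⁻¹ * ε x * δ⁻¹) * (δ * ε t * δ⁻¹)) * (x⁻¹ * ε x * δ⁻¹)⁻¹ * x⁻¹ := by group
    _ = x * ((δ * ε t * δ⁻¹) * (x⁻¹ * ε x * δ⁻¹)) * (x⁻¹ * ε x * δ⁻¹)⁻¹ * x⁻¹ := by rw [hcomm _ hw _ hθt]
    _ = x * (δ * ε t * δ⁻¹) * x⁻¹ := by group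

omit ε in
/-- `Ad(x)` carries `Cent(N)` onto `Cent(x N x⁻¹)`: `x t x⁻¹ ∈ Cent(γ) ↔ t ∈ Cent(N)` for `γ = x N x⁻¹` (plain group algebra). [cite: Rogawski1990, §3.10 p. 34] -/
theorem conj_mem_centralizer_singleton_iff {N x γ : G} (hγ : x * N * x⁻¹ = γ) (t : G) :
    x * t * x⁻¹ ∈ Subgroup.centralizer ({γ} : Set G) ↔ t ∈ Subgroup.centralizer ({N} : Set G) := by
  rw [Subgroup.mem_centralizer_singleton_iff, Subgroup.mem_centralizer_singleton_iff, ← hγ]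
  constructor
  · intro h
    calc t * N = x⁻¹ * (x * t * x⁻¹ * (x * N * x⁻¹)) * x := by group
      _ = x⁻¹ * (x * N * x⁻¹ * (x * t * x⁻¹)) * x := by rw [h]
      _ = N * t := by group
  · intro h
    calc x * t * x⁻¹ * (x * N * x⁻¹) = x * (t * N) * x⁻¹ := by group
      _ = x * (N * t) * x⁻¹ := by rw [h]
      _ = x * N * x⁻¹ * (x * t * x⁻¹) := by group

/-- **`x t x⁻¹` is `ε`-fixed iff `t ∈ G̃_{δε}`**, for `t ∈ Cent(N(δ))` (and `γ = x Nδ x⁻¹` `ε`-fixed, `Cent(Nδ)` commutative): by the intertwining,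
`ε(x t x⁻¹) = x t x⁻¹ ↔ δ ε(t) δ⁻¹ = t ↔ t δ ε(t)⁻¹ = δ` (★ `mem_epsCentralizer_iff`). [cite: Rogawski1990, §3.11 Prop. 3.11.2 pp. 34–35] -/
theorem apply_conj_eq_iff_mem_epsCentralizer (hε : ∀ g : G, ε (ε g) = g) {δ x γ : G}
    (hγ : x * epsNorm ε δ * x⁻¹ = γ) (hεγ : ε γ = γ)
    (hcomm : ∀ a ∈ Subgroup.centralizer ({epsNorm ε δ} : Set G), ∀ b ∈ Subgroup.centralizer ({epsNorm ε δ} : Set G), a * b = b * a)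
    {t : G} (ht : t ∈ Subgroup.centralizer ({epsNorm ε δ} : Set G)) :
    ε (x * t * x⁻¹) = x * t * x⁻¹ ↔ t ∈ epsCentralizer ε δ := by
  rw [apply_conj_eq_of_mem_centralizer_epsNorm ε hε hγ hεγ hcomm ht, mem_epsCentralizer_iff]
  constructor
  · intro h
    have h' : δ * ε t * δ⁻¹ = t := by
      calc δ * ε t * δ⁻¹ = x⁻¹ * (x * (δ * ε t * δ⁻¹) * x⁻¹) * x := by group
        _ = x⁻¹ * (x * t * x⁻¹) * x := by rw [h]
        _ = t := by group
    calc t * δ * (ε t)⁻¹ = δ * ε t * δ⁻¹ * δ * (ε t)⁻¹ := by rw [h']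
      _ = δ := by group
  · intro h
    have h' : δ * ε t * δ⁻¹ = t := by
      calc δ * ε t * δ⁻¹ = t * δ * (ε t)⁻¹ * ε t * δ⁻¹ := by rw [h]
        _ = t := by group
    rw [h']

/-- **`Ad(x) : G̃_{δε} ≅ Cent(γ) ∩ G̃^ε`** (membership form): `x t x⁻¹ ∈ Cent(γ)` and `ε(x t x⁻¹) = x t x⁻¹` iff `t ∈ G̃_{δε}` — with `G̃_{δε} ≤ Cent(Nδ)` (★
`epsCentralizer_le_centralizer_epsNorm`, (3.10.1)) for the converse. [cite: Rogawski1990, §3.10 (3.10.1) p. 34; §3.11 Prop. 3.11.2 pp. 34–35] -/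
theorem conj_mem_centralizer_and_apply_eq_iff (hε : ∀ g : G, ε (ε g) = g) {δ x γ : G}
    (hγ : x * epsNorm ε δ * x⁻¹ = γ) (hεγ : ε γ = γ)
    (hcomm : ∀ a ∈ Subgroup.centralizer ({epsNorm ε δ} : Set G), ∀ b ∈ Subgroup.centralizer ({epsNorm ε δ} : Set G), a * b = b * a)
    (t : G) :
    (x * t * x⁻¹ ∈ Subgroup.centralizer ({γ} : Set G) ∧ ε (x * t * x⁻¹) = x * t * x⁻¹) ↔ t ∈ epsCentralizer ε δ := by
  constructor
  · rintro ⟨hc, hfix⟩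
    have ht : t ∈ Subgroup.centralizer ({epsNorm ε δ} : Set G) := (conj_mem_centralizer_singleton_iff hγ t).mp hc
    exact (apply_conj_eq_iff_mem_epsCentralizer ε hε hγ hεγ hcomm ht).mp hfix
  · intro h
    have ht : t ∈ Subgroup.centralizer ({epsNorm ε δ} : Set G) := epsCentralizer_le_centralizer_epsNorm ε hε δ h
    exact ⟨(conj_mem_centralizer_singleton_iff hγ t).mpr ht, (apply_conj_eq_iff_mem_epsCentralizer ε hε hγ hεγ hcomm ht).mpr h⟩

end Generic

/-! ## §2 The S4 carriers: `G̃_{δε} ≃ₜ* G_{v,γ}` for ε-regular `δ` and `γ ∈ 𝒩(δ)` -/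

section GtLoc

variable (L : Type) [Field L] [NumberField L] [IsCMField L] (Φ : GL (Fin 3) L)
  (v : HeightOneSpectrum (𝓞 ↥(maximalRealSubfield L)))

/-- **The centraliser of an ε-regular norm is commutative**: for `δ ∈ G̃_v` with `N(δ)` regular (★ `IsEpsRegularAt`: separable characteristic polynomial), any two
elements of `Cent_{G̃_v}(N(δ))` commute (★ `Matrix.GeneralLinearGroup.commute_of_commute_of_charpoly_separable` over `L ⊗ L⁺_v = Π_{w∣v} L_w`, a product of fields).
[cite: Rogawski1990, §3.1 p. 19; §3.11 p. 34] -/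
theorem mul_comm_of_mem_centralizer_epsNorm {δ : GtLoc L v} (hδ : IsEpsRegularAt L Φ v δ)
    {a b : GtLoc L v} (ha : a ∈ Subgroup.centralizer ({epsNorm (epsLoc L Φ v) δ} : Set (GtLoc L v)))
    (hb : b ∈ Subgroup.centralizer ({epsNorm (epsLoc L Φ v) δ} : Set (GtLoc L v))) : a * b = b * a := by
  rw [Subgroup.mem_centralizer_singleton_iff] at ha hb
  exact (Matrix.GeneralLinearGroup.commute_of_commute_of_charpoly_separable
    (K := fun w : UnitaryGroup.PlacesOver L v => w.1.adicCompletion L) (RingHom.id _) (fun _ _ h => h) hδ ha hb).eq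

/-- **`G̃_{δε} ≅ G_{v,γ}` — THE ε-CENTRALISER OF AN ε-REGULAR `δ` IS THE `G_v`-CENTRALISER OF ANY `γ ∈ 𝒩(δ)`, as topological groups.**  For hermitian `Φ`, ε-regular
`δ ∈ G̃_v` and `γ ∈ G_v` with `N(δ) ~ γ` in `G̃_v` (★ `IsEpsNormPair`), there are `x ∈ G̃_v` with `x N(δ) x⁻¹ = γ` and a topological-group isomorphism
`e : G̃_{δε} ≃ₜ* Cent_{G_v}(γ)` with `e(t) = x t x⁻¹` (§1 at `ε_v`, which is an involution ★ `twistLocal_twistLocal_cm`; `G_v = G̃_v^{ε_v}` ★ `epsLoc_eq_self_iff_mem_local`;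
continuity of conjugation).  This is the torus identification behind the twisted Weyl integration formula (p. 186: the sum over `T`, `D_{G̃ε}(δ) = D_G(Nδ)`).
[cite: Rogawski1990, §3.11 Prop. 3.11.2 pp. 34–35; §12.5 p. 186] -/
theorem exists_continuousMulEquiv_epsCentralizer_centralizer
    (hΦ : ((Φ : GL (Fin 3) L) : Matrix (Fin 3) (Fin 3) L)ᵀ.map (IsCMField.complexConj L) = (Φ : Matrix (Fin 3) (Fin 3) L))
    {δ : GtLoc L v} (hδ : IsEpsRegularAt L Φ v δ)
    {γ : (UnitaryGroup.cmDatum L 3 (Φ : Matrix (Fin 3) (Fin 3) L)).Local v} (hγ : IsEpsNormPair L Φ v δ γ) :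
    ∃ (x : GtLoc L v) (e : ↥(epsCentralizer (epsLoc L Φ v) δ) ≃ₜ*
        ↥(Subgroup.centralizer ({γ} : Set ((UnitaryGroup.cmDatum L 3 (Φ : Matrix (Fin 3) (Fin 3) L)).Local v)))),
      x * epsNorm (epsLoc L Φ v) δ * x⁻¹ = γ.val ∧
        ∀ t, (((e t : ↥(Subgroup.centralizer ({γ} : Set ((UnitaryGroup.cmDatum L 3 (Φ : Matrix (Fin 3) (Fin 3) L)).Local v)))) :
          (UnitaryGroup.cmDatum L 3 (Φ : Matrix (Fin 3) (Fin 3) L)).Local v).val : GtLoc L v) = x * (t : GtLoc L v) * x⁻¹ := by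
  have hε : ∀ g : GtLoc L v, epsLoc L Φ v (epsLoc L Φ v g) = g := fun g => twistLocal_twistLocal_cm L 3 Φ hΦ v g
  obtain ⟨x, hx⟩ := isConj_iff.mp hγ
  have hεγ : epsLoc L Φ v γ.val = γ.val := epsLoc_apply_coe L Φ v γ
  have hcomm : ∀ a ∈ Subgroup.centralizer ({epsNorm (epsLoc L Φ v) δ} : Set (GtLoc L v)),
      ∀ b ∈ Subgroup.centralizer ({epsNorm (epsLoc L Φ v) δ} : Set (GtLoc L v)), a * b = b * a :=
    fun a ha b hb => mul_comm_of_mem_centralizer_epsNorm L Φ v hδ ha hb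
  -- membership bookkeeping between `Cent_{G_v}(γ)` and `Cent_{G̃_v}(γ.val) ∩ G_v`
  have key := fun t : GtLoc L v => conj_mem_centralizer_and_apply_eq_iff (epsLoc L Φ v) hε hx hεγ hcomm t
  have hcentU : ∀ s : (UnitaryGroup.cmDatum L 3 (Φ : Matrix (Fin 3) (Fin 3) L)).Local v,
      s ∈ Subgroup.centralizer ({γ} : Set ((UnitaryGroup.cmDatum L 3 (Φ : Matrix (Fin 3) (Fin 3) L)).Local v)) ↔
        s.val ∈ Subgroup.centralizer ({γ.val} : Set (GtLoc L v)) := by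
    intro s
    rw [Subgroup.mem_centralizer_singleton_iff, Subgroup.mem_centralizer_singleton_iff]
    exact ⟨fun h => congrArg Subtype.val h, fun h => Subtype.ext h⟩
  -- the forward map lands in `G_v` and in `Cent(γ)`
  have hfwdU : ∀ t : ↥(epsCentralizer (epsLoc L Φ v) δ),
      x * (t : GtLoc L v) * x⁻¹ ∈ UnitaryGroup.local L (IsCMField.complexConj L) 3 (Φ : Matrix (Fin 3) (Fin 3) L) v := fun t =>
    (epsLoc_eq_self_iff_mem_local L Φ v _).mp ((key t).mpr t.2).2
  have hfwdC : ∀ t : ↥(epsCentralizer (epsLoc L Φ v) δ),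
      (⟨x * (t : GtLoc L v) * x⁻¹, hfwdU t⟩ : (UnitaryGroup.cmDatum L 3 (Φ : Matrix (Fin 3) (Fin 3) L)).Local v) ∈
        Subgroup.centralizer ({γ} : Set ((UnitaryGroup.cmDatum L 3 (Φ : Matrix (Fin 3) (Fin 3) L)).Local v)) := fun t =>
    (hcentU _).mpr ((key t).mpr t.2).1
  -- the backward map lands in `G̃_{δε}`
  have hbwd : ∀ s : ↥(Subgroup.centralizer ({γ} : Set ((UnitaryGroup.cmDatum L 3 (Φ : Matrix (Fin 3) (Fin 3) L)).Local v))),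
      x⁻¹ * ((s : (UnitaryGroup.cmDatum L 3 (Φ : Matrix (Fin 3) (Fin 3) L)).Local v).val : GtLoc L v) * x ∈ epsCentralizer (epsLoc L Φ v) δ := by
    intro s
    apply (key _).mp
    have hs : x * (x⁻¹ * ((s : (UnitaryGroup.cmDatum L 3 (Φ : Matrix (Fin 3) (Fin 3) L)).Local v).val : GtLoc L v) * x) * x⁻¹ =
        ((s : (UnitaryGroup.cmDatum L 3 (Φ : Matrix (Fin 3) (Fin 3) L)).Local v).val : GtLoc L v) := by group
    rw [hs]
    exact ⟨(hcentU _).mp s.2, epsLoc_apply_coe L Φ v _⟩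
  refine ⟨x,
    { toFun := fun t => ⟨⟨x * (t : GtLoc L v) * x⁻¹, hfwdU t⟩, hfwdC t⟩
      invFun := fun s => ⟨x⁻¹ * ((s : (UnitaryGroup.cmDatum L 3 (Φ : Matrix (Fin 3) (Fin 3) L)).Local v).val : GtLoc L v) * x, hbwd s⟩
      left_inv := fun t => by
        apply Subtype.ext
        change x⁻¹ * (x * (t : GtLoc L v) * x⁻¹) * x = (t : GtLoc L v)
        group
      right_inv := fun s => by
        apply Subtype.ext
        apply Subtype.ext
        change x * (x⁻¹ * ((s : (UnitaryGroup.cmDatum L 3 (Φ : Matrix (Fin 3) (Fin 3) L)).Local v).val : GtLoc L v) * x) * x⁻¹ = _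
        group
      map_mul' := fun s t => by
        apply Subtype.ext
        apply Subtype.ext
        change x * ((s : GtLoc L v) * (t : GtLoc L v)) * x⁻¹ = x * (s : GtLoc L v) * x⁻¹ * (x * (t : GtLoc L v) * x⁻¹)
        group
      continuous_toFun := by
        apply Continuous.subtype_mk
        apply Continuous.subtype_mk
        exact (continuous_const.mul continuous_subtype_val).mul continuous_const
      continuous_invFun := by
        apply Continuous.subtype_mk
        exact (continuous_const.mul (continuous_subtype_val.comp continuous_subtype_val)).mul continuous_const }, hx, fun t => rfl⟩

end GtLoc

/-! ## §3 The `D`-germ: `γ ∈ 𝒩(δ)` has the characteristic polynomial of `N(δ)` -/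

section Germ

variable {L : Type} [Field L] [NumberField L] [IsCMField L] {Φ : GL (Fin 3) L}
  {v : HeightOneSpectrum (𝓞 ↥(maximalRealSubfield L))}

/-- **`char(γ) = char(N(δ))` for `γ ∈ 𝒩(δ)`** (conjugate matrices; Mathlib `Matrix.charpoly_units_conj`): every weight built from the characteristic polynomial —
the datum letter `D_T(t) = √(∏_w |disc χ_t|_w · (∏_w |det t|_w)⁻²)` of the tree's Weyl integration formula for `G_v` — takes the same value at `γ` and at `N(δ)`; this is
print's `D_{G̃ε}(δ) = D_G(Nδ)` (p. 186) once `D_{G̃ε}` is defined through the norm. [cite: Rogawski1990, §12.5 p. 186; §3.11 p. 34] -/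
theorem charpoly_coe_eq_of_isEpsNormPair {δ : GtLoc L v} {γ : (UnitaryGroup.cmDatum L 3 (Φ : Matrix (Fin 3) (Fin 3) L)).Local v}
    (hγ : IsEpsNormPair L Φ v δ γ) :
    ((γ.val : GtLoc L v) : Matrix (Fin 3) (Fin 3) (UnitaryGroup.LocalRing L v)).charpoly =
      ((epsNorm (epsLoc L Φ v) δ : GtLoc L v) : Matrix (Fin 3) (Fin 3) (UnitaryGroup.LocalRing L v)).charpoly := by
  obtain ⟨x, hx⟩ := isConj_iff.mp hγ
  rw [← hx, Units.val_mul, Units.val_mul, Matrix.coe_units_inv, Matrix.charpoly_units_conj]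

/-- **Norms of ε-regular elements are regular in `G_v`**: `γ ∈ 𝒩(δ)` with `δ` ε-regular has separable characteristic polynomial (★ `IsRegularElt`), so `γ` is a
regular semisimple element of `G_v ⊂ G̃_v` — the `𝒩`-image of the ε-regular set lies in the regular set (p. 186). [cite: Rogawski1990, §3.11 p. 34; §12.5 p. 186] -/
theorem isRegularElt_coe_of_isEpsNormPair {δ : GtLoc L v} (hδ : IsEpsRegularAt L Φ v δ)
    {γ : (UnitaryGroup.cmDatum L 3 (Φ : Matrix (Fin 3) (Fin 3) L)).Local v} (hγ : IsEpsNormPair L Φ v δ γ) :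
    IsRegularElt (γ.val : GtLoc L v) := by
  rw [isRegularElt_iff, charpoly_coe_eq_of_isEpsNormPair hγ]
  exact hδ

end Germ

end Summit.HodgeConjecture.HodgeConjecture.R90.S4

end
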